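import Summits.CriticalPhenomena.Ising3DConformalLimit.Theorems.PrecisionLaplacianDirectCorrelationStableTailConverseSpine
import Summits.CriticalPhenomena.Ising3DConformalLimit.Theorems.PrecisionLaplacianDirectCorrelationStableTailLogicalMap
import Summits.CriticalPhenomena.Ising3DConformalLimit.Theorems.CanonicalBranchRefutationInfraredExponentZeroConjunct
import Summits.CriticalPhenomena.Ising3DConformalLimit.Theorems.CanonicalBranchRefutationInfraredExponentZeroDichotomy
import HarnessLib

/-!
# Crux `PrecisionLaplacian.DirectCorrelationStableTail` (stmt-CriticalPhenomena-4799) follows from item 0634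
# together with the route's OWN cruxes r5 (`MoebiusLimitOfTwoPointLaw`, stmt-4801) and r6
# (`IsingEuclidUpgradeR4NonGaussian`, stmt-0636) — hypothesis-free in `H` and in `IM`.

Strategist `planner-cstrat-stmt-CriticalPhenomena-4799-p1-0`, 2026-08-17 (candidate Theorems file; Theorems/ is prover-only for
planners, so this is attached as evidence and recommended for landing as
`Theorems/PrecisionLaplacianDirectCorrelationStableTailOfRouteCruxes.lean --supports stmt-CriticalPhenomena-4799`).

Chain (all ingredients LANDED):
* `¬ NonSaturation → InfraredExponentZero` (`Theorems.infraredExponentZero_of_not_nonSaturation`, MMS + Simon–Lieb, p-landed in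
  `CanonicalBranchRefutationInfraredExponentZeroDichotomy.lean`);
* `InfraredExponentZero →` every non-degenerate pointwise scaling limit of `criticalCorr 3` has `U₄ ≡ 0`
  (`Theorems.not_hasNontrivialU4_of_infraredExponentZero`, the canonical-branch Wick rigidity of the CLOSED route
  CanonicalBranchRefutation, `CanonicalBranchRefutationInfraredExponentZeroConjunct.lean`);
* item 0634 feeds r5, which yields such a limit; r6 says it has `U₄ ≢ 0`; contradiction ⇒ `NonSaturation` (item 1342);
* `NonSaturation → 0634 → crux` is the landed converse two-point spine `DirectCorrelationStableTail_of` (p138781).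

Consequences recorded here, kernel-checked:
1. `nonSaturation_of_twoPointLaw_moebius_nonGauss : 0634 → 4801 → 0636 → 1342`;
2. `DirectCorrelationStableTail_of_routeCruxes : 0634 → 4801 → 0636 → crux r3` — inside route PrecisionLaplacian the crux r3 costs
   NOTHING beyond item 0634, given the cruxes r5, r6 that `closes` consumes anyway;
3. `ising3DConformalLimit_of_twoPointLaw_moebius_nonGauss : 0634 → 4801 → 0636 → Ising3DConformalLimit` — the route's deciding
   theorem can be re-glued WITHOUT `InverseMFerromagnet` (IM, r2) and WITHOUT `DirectCorrelationStableTail` (r3): the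
   precision-Laplacian spine is a dividend of the route, not a load-bearing part of its cone (finding for the tenure planner).
-/

namespace Summit.CriticalPhenomena.Ising3DConformalLimit.Cruxes.DirectCorrelationStableTail.Strategist

open Summit.CriticalPhenomena.Ising3DConformalLimit.Theses
open Summit.CriticalPhenomena.Ising3DConformalLimit.Theorems

/-- **Item 1342 from items 0634, 4801, 0636** (no `H`, no `IM`): an isotropic pure power law of the critical two-point
function, the Möbius-limit upgrade r5 and non-Gaussianity r6 force non-saturation of the infrared bound — because on the
saturated branch `η_log = 0` and every non-degenerate pointwise limit is Wick (canonical-branch rigidity, landed). -/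
theorem nonSaturation_of_twoPointLaw_moebius_nonGauss
    (h0634 : IsingEuclidUpgrade.IsingEuclidUpgradeR2RotInvPowerLaw)
    (h4801 : PrecisionLaplacian.MoebiusLimitOfTwoPointLaw)
    (h0636 : PrecisionLaplacian.IsingEuclidUpgradeR4NonGaussian) :
    PerfectScreening.NonSaturation := by
  by_contra hNS
  have hZ : CanonicalBranchRefutation.InfraredExponentZero := infraredExponentZero_of_not_nonSaturation hNS
  obtain ⟨ρ, Δ, S, hρ, _hΔ, hlim, hnd, _hmoeb⟩ := h4801 h0634
  exact not_hasNontrivialU4_of_infraredExponentZero hZ hρ hlim hnd (h0636 ρ S hρ hlim hnd)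

/-- **Crux r3 from item 0634 and the route's own cruxes r5, r6** (no `H`, no `IM`). -/
theorem DirectCorrelationStableTail_of_routeCruxes
    (h0634 : IsingEuclidUpgrade.IsingEuclidUpgradeR2RotInvPowerLaw)
    (h4801 : PrecisionLaplacian.MoebiusLimitOfTwoPointLaw)
    (h0636 : PrecisionLaplacian.IsingEuclidUpgradeR4NonGaussian) :
    PrecisionLaplacian.DirectCorrelationStableTail :=
  DiffusiveBranchIsNonsaturation.DirectCorrelationStableTail_of
    (nonSaturation_of_twoPointLaw_moebius_nonGauss h0634 h4801 h0636) h0634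

/-- **The route's conclusion from 0634, r5, r6 alone**: the deciding theorem of route PrecisionLaplacian can be re-glued
without IM (r2) and without TAIL (r3).  (Same three lines as the tail of the current `closes`.) -/
theorem ising3DConformalLimit_of_twoPointLaw_moebius_nonGauss
    (h0634 : IsingEuclidUpgrade.IsingEuclidUpgradeR2RotInvPowerLaw)
    (h4801 : PrecisionLaplacian.MoebiusLimitOfTwoPointLaw)
    (h0636 : PrecisionLaplacian.IsingEuclidUpgradeR4NonGaussian) :
    _root_.Ising3DConformalLimit := by
  obtain ⟨ρ, Δ, S, hρ, hΔ, hlim, hnd, hmoeb⟩ := h4801 h0634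
  exact ⟨ρ, Δ, S, hρ, hΔ, hlim, hnd, hmoeb, h0636 ρ S hρ hlim hnd⟩

/-- **Hence, inside the route, r3 ⟺ 0634 exactly** (given r2-via-4802's `H` for ⇒, and r5, r6 for ⇐):
the forward direction is the hypothesis-free logical map p139683. -/
theorem twoPointLaw_of_DirectCorrelationStableTail
    (hT : PrecisionLaplacian.DirectCorrelationStableTail)
    (hH : ∀ A : Finset (Literature.Probability.LatticeModels.Site 3),
      (Matrix.of fun (p q : ↥A) => Literature.Probability.LatticeModels.criticalTwoPoint 3 (q.1 - p.1)).PosDef ∧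
        ∀ u v : ↥A, (u ≠ v → (Matrix.of fun (p q : ↥A) =>
          Literature.Probability.LatticeModels.criticalTwoPoint 3 (q.1 - p.1))⁻¹ u v ≤ 0) ∧
          0 ≤ ∑ w, (Matrix.of fun (p q : ↥A) => Literature.Probability.LatticeModels.criticalTwoPoint 3 (q.1 - p.1))⁻¹ u w) :
    IsingEuclidUpgrade.IsingEuclidUpgradeR2RotInvPowerLaw ∧ PerfectScreening.NonSaturation :=
  (DiffusiveBranchIsNonsaturation.directCorrelationStableTail_iff_symmPotential_imp.1 hT) hH

#print axioms DirectCorrelationStableTail_of_routeCruxes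
#print axioms ising3DConformalLimit_of_twoPointLaw_moebius_nonGauss

end Summit.CriticalPhenomena.Ising3DConformalLimit.Cruxes.DirectCorrelationStableTail.Strategist
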